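import Mathlib
import Summits.NavierStokesRegularity.NavierStokesRegularity.Theses.ExtremiserTransience
import HarnessLib

/-!
# `ExtremiserTransience.Assembly` — the route's assembly (item stmt-NavierStokesRegularity-21886;
  pure logic)

**Statement.** `NearExtremalTransience → DepletionCascade → NoTypeII → AveragedRung →
NavierStokesRegularity`.

PROOF. The route file `Theses/ExtremiserTransience.lean` carries the planner-authored,
kernel-checked deciding theorem `Theses.ExtremiserTransience.closes`, whose hypotheses are exactly
the route's three cruxes and one support and whose conclusion is the sub-problem Statement; the
assembly item is that implication written as ONE proposition (the curried form of `closes`), so it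
is closed by applying `closes` to the hypotheses. This proves an IMPLICATION only: the four
hypotheses (three of them open cruxes) remain hypotheses.

HONEST FRAMING: pure logic between the route's own statements; the file does NOT prove
`NavierStokesRegularity` — it proves that the route's four items would imply it.
-/

noncomputable section

set_option linter.dupNamespace false

namespace Summit.NavierStokesRegularity.NavierStokesRegularity.Theorems

open Summit.NavierStokesRegularity.NavierStokesRegularity.Theses.ExtremiserTransience in
/-- **Item stmt-NavierStokesRegularity-21886** (`ExtremiserTransience.Assembly`): the route's three
cruxes and one support imply the sub-problem Statement, by the route file's deciding theorem
`closes` (an implication; its hypotheses stay hypotheses). [this file] -/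
theorem extremiserTransience_assembly_proof :
    Summit.NavierStokesRegularity.NavierStokesRegularity.Theses.ExtremiserTransience.Assembly := by
  unfold Summit.NavierStokesRegularity.NavierStokesRegularity.Theses.ExtremiserTransience.Assembly
  -- (buildfix 2026-08-28) the route's `closes` was re-keyed (07:22Z) to the PER-FLOW transience
  -- item `NearExtremalTransiencePerFlow`; this CLOSED assembly keeps its accepted statement over the
  -- universal-θ crux `NearExtremalTransience`, which gives the per-flow exponent by instantiation, so
  -- the chain of `closes` is inlined with that instantiation (statement byte-identical).
  intro h₁ hC hII hA
  apply Summit.NavierStokesRegularity.NavierStokesRegularity.Theorems.navierStokesRegularity_of_noBlowup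
  intro ν T hν hT0 u p hcl hLH hdec
  by_contra hext
  obtain ⟨C', hC'⟩ := hII ν T hν hT0 u p ⟨hcl, hext⟩ hLH hdec
  have hν' : 0 < Real.sqrt ν := Real.sqrt_pos.2 hν
  have hCpos : 0 < max (C' / Real.sqrt ν) 1 := lt_of_lt_of_le one_pos (le_max_right _ _)
  have hrate : ∀ᶠ t in nhdsWithin T (Set.Iio T), ∀ x,
      Real.sqrt (T - t) * ‖u t x‖ ≤ max (C' / Real.sqrt ν) 1 * Real.sqrt ν := by
    have hlt : ∀ᶠ t in nhdsWithin T (Set.Iio T), t < T := self_mem_nhdsWithin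
    filter_upwards [hC', hlt] with t ht htT
    intro x
    have hTt : 0 < Real.sqrt (T - t) := Real.sqrt_pos.2 (sub_pos.2 htT)
    calc Real.sqrt (T - t) * ‖u t x‖
        ≤ Real.sqrt (T - t) * (C' / Real.sqrt (T - t)) := mul_le_mul_of_nonneg_left (ht x) hTt.le
      _ = C' := by field_simp
      _ = (C' / Real.sqrt ν) * Real.sqrt ν := by field_simp
      _ ≤ max (C' / Real.sqrt ν) 1 * Real.sqrt ν := mul_le_mul_of_nonneg_right (le_max_left _ _) hν'.le
  have hr : (0 : ℝ) < 1 / (2 * max (C' / Real.sqrt ν) 1) := by positivity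
  have hrC : 1 / (2 * max (C' / Real.sqrt ν) 1) * max (C' / Real.sqrt ν) 1 < 1 := by
    rw [div_mul_eq_mul_div, one_mul, div_lt_one (by positivity)]
    linarith
  -- the universal exponent θ < 1 of `NearExtremalTransience`, instantiated at this flow, is exactly
  -- the hypothesis the cascade consumes
  obtain ⟨θ, hθ0, hθ1, H⟩ := h₁
  have hdr := hC _ ν T hCpos hν hT0 u p hcl hLH hdec hrate hext
    ⟨θ, hθ0, hθ1, fun κ hκ => H κ hκ _ ν T hCpos hν hT0 u p hcl hLH hdec hrate hext⟩ _ hr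
  exact hext (hA _ _ ν T hr.le hCpos hrC hν hT0 u p hcl hLH hdec hrate hdr)

end Summit.NavierStokesRegularity.NavierStokesRegularity.Theorems

end
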